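import Literature.AlgebraicGeometry.Frobenioids.PerfFactorialWeakFinite
import Literature.AlgebraicGeometry.Frobenioids.MonoidFunctors
import HarnessLib

/-!
# Frobenioids I, Def. 2.4 (i) / Prop. 5.3 — disjointly supported images of distinct primes under `f^pf`, from a
# "prime-separating" property of `f` read in `M` and `N` themselves (no perfections, no realifications)

Mochizuki, *The geometry of Frobenioids I*, Kyushu J. Math. **62** (2008), §0 p. 12 (primary elements, primes,
`M → M^pf` induces `Prime(M) ⥲ Prime(M^pf)`), Def. 2.4 (i) p. 47 (the factorization `M^pf → ∏_𝔮 M^rlf_𝔮` and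
`Supp`) [cite: MochizukiFrdI2008, Def. 2.4(i) p.47] [cite: MochizukiFrdI2008, §0 p.12].

abc-iut cell, seat abc-iut-w5-d153 (gen 4).  PROOF-ONLY (theorems only).  The injectivity reductions for realified
pull-backs (this seat's `RealificationMapInjectiveCountableSupp(Weak).lean`, [EtTh]-side `Sec3BLambdaInjectiveOfRlfR(Weak).lean`)
take the hypothesis

  `hdisj : ∀ 𝔭 ≠ 𝔮` primes of `M^pf`, `∀ x ∈ 𝔭, y ∈ 𝔮, Disjoint (Supp (ι_N (f^pf x))) (Supp (ι_N (f^pf y)))`.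

This file reduces `hdisj` to an elementary property of `f : M → N` that a model can verify by hand:

  **`f` separates primes**: for primary `x₀, y₀ ∈ M` with `¬ x₀ ≼ y₀` (i.e. of distinct primes) every `d ∈ N` with
  `d ≼ f x₀` and `d ≼ f y₀` is trivial

(`IsPerfFactorialWeak.disjoint_supp_factorMap_map_of_separating`, weak vocabulary, `M` sharp, `N` weakly perf-factorial;
`…toRealification…` restates it with `ι_N`).  Steps: a prime `𝔯` in both supports yields primaries `r ∼ r'` of `N^pf`
dividing `f^pf x`, `f^pf y` (`factorMap_apply_eq_one`); `≼` descends along `a^{1/k} ∼ a` (`Perfection.precsim_of_mk_precsim_mk`,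
`Perfection.isPrimary_of_isPrimary_mk`); separation forces `r = 1`.  HONEST FRAMING: elementary monoid algebra; nothing here
bears on [IUTchIII] Cor. 3.12.
-/

noncomputable section

namespace Literature.AlgebraicGeometry.Frobenioids

open Function

universe u

variable {M N : Type u} [CommMonoid M] [CommMonoid N]

/-- `≼` descends along `a^{1/m} ∼ a`: `a^{1/m} ≼ b^{1/k}` in `M^pf` implies `a ≼ b` in `M`. [cite: MochizukiFrdI2008, §0 p.12] -/
theorem Perfection.precsim_of_mk_precsim_mk {a b : M} {m k : ℕ+}
    (h : Perfection.mk a m ≼ Perfection.mk b k) : a ≼ b :=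
  Perfection.of_precsim_of_iff.mp
    (((Perfection.mk_precsim_of a m).2.trans h).trans (Perfection.mk_precsim_of b k).1)

/-- If `a^{1/k}` is primary in `M^pf` (`M` sharp) then `a` is primary in `M` (`a^{1/k} ∼ a` and `M → M^pf` reflects primality).
[cite: MochizukiFrdI2008, §0 p.12] -/
theorem Perfection.isPrimary_of_isPrimary_mk (hM : IsSharp M) {a : M} {k : ℕ+} (h : IsPrimary (Perfection.mk a k)) :
    IsPrimary a := by
  have ha1 : a ≠ 1 := fun ha => h.1 ((Perfection.mk_eq_one_iff_of_isSharp hM).mpr ha)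
  have hof : IsPrimary (Perfection.of M a) := by
    refine h.of_precsim (Perfection.mk_precsim_of a k).2 ?_
    rw [Perfection.of_apply]
    exact fun h1 => ha1 ((Perfection.mk_eq_one_iff_of_isSharp hM).mp h1)
  exact (Perfection.isPrimary_of_iff hM).mp hof

/-- **Distinct primes of `M^pf` have disjointly supported images under `f^pf`, as soon as `f` SEPARATES PRIMES** (for primary
`x₀, y₀ ∈ M` of distinct `≼`-classes, no non-trivial `d ∈ N` lies `≼`-below both `f x₀` and `f y₀`); `M` sharp, `N` weakly
perf-factorial, supports read in `∏_𝔯 N^rlf_𝔯`. [cite: MochizukiFrdI2008, Def. 2.4(i) p.47] -/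
theorem IsPerfFactorialWeak.disjoint_supp_factorMap_map_of_separating (hM : IsSharp M) (hN : IsPerfFactorialWeak N)
    (f : M →* N)
    (hsep : ∀ x₀ y₀ : M, IsPrimary x₀ → IsPrimary y₀ → ¬ x₀ ≼ y₀ → ∀ d : N, d ≼ f x₀ → d ≼ f y₀ → d = 1)
    {𝔭 𝔮 : Primes (Perfection M)} (hne : 𝔭 ≠ 𝔮) {x y : Perfection M} (hx : x ∈ 𝔭.carrier) (hy : y ∈ 𝔮.carrier) :
    Disjoint (supp (factorMap N (Perfection.map f x))) (supp (factorMap N (Perfection.map f y))) := by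
  classical
  rw [Set.disjoint_left]
  intro 𝔯 h𝔯x h𝔯y
  -- primaries `r ∼ r'` of `N^pf` in the class `𝔯` dividing the two images
  obtain ⟨r, hr, hrx⟩ : ∃ r ∈ 𝔯.carrier, r ∣ Perfection.map f x := by
    by_contra hno
    exact h𝔯x (hN.factorMap_apply_eq_one fun r hr hrx => hno ⟨r, hr, hrx⟩)
  obtain ⟨r', hr', hr'y⟩ : ∃ r ∈ 𝔯.carrier, r ∣ Perfection.map f y := by
    by_contra hno
    exact h𝔯y (hN.factorMap_apply_eq_one fun r hr hry => hno ⟨r, hr, hry⟩)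
  have h1 : r ≼ Perfection.map f x := Precsim.of_dvd hrx
  have h2 : r ≼ Perfection.map f y := (𝔯.precsim_of_mem_carrier hr hr').trans (Precsim.of_dvd hr'y)
  have hr1 : r ≠ 1 := hr.1.1
  -- descend to `M` and `N`
  obtain ⟨⟨r₀, m⟩, rfl⟩ := Perfection.mk_surjective r
  obtain ⟨⟨x₀, k⟩, rfl⟩ := Perfection.mk_surjective x
  obtain ⟨⟨y₀, l⟩, rfl⟩ := Perfection.mk_surjective y
  dsimp only at h1 h2 hr1 hx hy
  rw [Perfection.map_mk] at h1 h2
  have h1' : r₀ ≼ f x₀ := Perfection.precsim_of_mk_precsim_mk h1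
  have h2' : r₀ ≼ f y₀ := Perfection.precsim_of_mk_precsim_mk h2
  have hx₀ : IsPrimary x₀ := Perfection.isPrimary_of_isPrimary_mk hM hx.1
  have hy₀ : IsPrimary y₀ := Perfection.isPrimary_of_isPrimary_mk hM hy.1
  have hxy : ¬ x₀ ≼ y₀ := by
    intro hxy₀
    apply hne
    have hxy' : Perfection.mk x₀ k ≼ Perfection.mk y₀ l :=
      ((Perfection.mk_precsim_of x₀ k).1.trans (Perfection.of_precsim_of_iff.mpr hxy₀)).trans
        (Perfection.mk_precsim_of y₀ l).2
    obtain ⟨hx', rfl⟩ := hx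
    obtain ⟨hy', rfl⟩ := hy
    exact Quotient.sound hxy'
  have hr₀ : r₀ = 1 := hsep x₀ y₀ hx₀ hy₀ hxy r₀ h1' h2'
  exact hr1 ((Perfection.mk_eq_one_iff_of_isSharp hN.isDivisorial.isSharp).mpr hr₀)

/-- The same with the supports written through `ι_N : N^pf → N^rlf` (the form of the hypothesis `hdisj` of
`IsPerfFactorialWeak.Rlf.injective_of_disjoint_supp_of_countable` and of the [EtTh]-side `ofRlfRWeak_…_of_disjoint_supp_…`).
[cite: MochizukiFrdI2008, Def. 2.4(i) p.47] -/
theorem IsPerfFactorialWeak.disjoint_supp_toRealification_map_of_separating (hM : IsSharp M)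
    (hN : IsPerfFactorialWeak N) (f : M →* N)
    (hsep : ∀ x₀ y₀ : M, IsPrimary x₀ → IsPrimary y₀ → ¬ x₀ ≼ y₀ → ∀ d : N, d ≼ f x₀ → d ≼ f y₀ → d = 1) :
    ∀ (𝔭 𝔮 : Primes (Perfection M)), 𝔭 ≠ 𝔮 → ∀ x ∈ 𝔭.carrier, ∀ y ∈ 𝔮.carrier,
      Disjoint (supp (hN.toRealification (Perfection.map f x) : RlfFactor N))
        (supp (hN.toRealification (Perfection.map f y) : RlfFactor N)) :=
  fun _ _ hne _ hx _ hy => hN.disjoint_supp_factorMap_map_of_separating hM f hsep hne hx hy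

/-- Strong-vocabulary form (`N` perf-factorial as printed; `ι_N = IsPerfFactorial.toRealification`).
[cite: MochizukiFrdI2008, Def. 2.4(i) p.47] -/
theorem IsPerfFactorial.disjoint_supp_toRealification_map_of_separating (hM : IsSharp M)
    (hN : IsPerfFactorial N) (f : M →* N)
    (hsep : ∀ x₀ y₀ : M, IsPrimary x₀ → IsPrimary y₀ → ¬ x₀ ≼ y₀ → ∀ d : N, d ≼ f x₀ → d ≼ f y₀ → d = 1) :
    ∀ (𝔭 𝔮 : Primes (Perfection M)), 𝔭 ≠ 𝔮 → ∀ x ∈ 𝔭.carrier, ∀ y ∈ 𝔮.carrier,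
      Disjoint (supp (hN.toRealification (Perfection.map f x) : RlfFactor N))
        (supp (hN.toRealification (Perfection.map f y) : RlfFactor N)) :=
  fun _ _ hne _ hx _ hy => hN.weak.disjoint_supp_factorMap_map_of_separating hM f hsep hne hx hy

end Literature.AlgebraicGeometry.Frobenioids

end
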